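import Summits.CriticalPhenomena.PercolationContinuityZ3.Theorems.Transplant.KNLevelsHGluing
import HarnessLib

/-!
# Corridor, generic part 1 — CHAINS of target steps: iterating the target property over levels (the engine of Kozma–Nitzan's Lemmas 11–12:
# `levelChain`, `halvingChain`, `corridorStep` of `L/KozmaNitzanCorridor.lean`, with the `ℤ^d` boxes abstracted into per-step level data and kits)

builds on p205010 (kernel theorem, internal audit signed; external expert review pending) — nothing in this file uses p205010.
Lane `prim-bschramm`, seat `prim-bschramm-stmt` (task "Corridor generic over levels", lead 08:19Z; input = `KNLevels.TargetProperty G Δ p` of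
`KNLevelsHGluing.lean`).  Kozma–Nitzan prove Lemma 11 (elongated boxes are hittable, p. 22) and Lemma 12 (the corridor, pp. 23–25) by APPLYING
LEMMA 10 REPEATEDLY: each application moves a set `B` reached with probability `> 1 - δ` to a target `T` reached with probability `> 1 - ε`, and
the next application starts from `T ⊆ B'`.  Over levels, one application is a `TStep` (level datum `L`, subbox `D`, target `T`, depth `R`,
contact count `N`, level window `[j₀, j₁]`) equipped with KITS AT ACCURACY `δ` (`TStep.KitsAt`: exactly the hypotheses of `TargetProperty`);
the geometry of the boxes is the instance's business (for `ℤ^d`: the signed boxes `sBox` of the original; for `X □ ℤ²`: prisms).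

* `TStep`, `TStep.KitsAt` (monotone in `δ`: `KitsAt.mono`), `TargetProperty.apply_step`;
* **`TargetProperty.chain`** — for every `ε > 0` and length `n` there is ONE accuracy `δ ∈ (0,1]` such that every chain of `n + 1` steps with a
  common source, linked by `T_i ⊆ B_{i+1} = X_{i+1}(0)`, all with kits at accuracy `δ`, satisfies
  `1 - δ < P_W(o ↔ B_0) ⟹ 1 - ε < P_W(o ↔ T_n)` (backward induction on the chain, KN p. 22 "each time moving the face").
[cite: KozmaNitzan2024, §4 Lemma 11 (p. 22), Lemma 12 (pp. 23–25)]
-/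

noncomputable section

open MeasureTheory ProbabilityTheory

namespace Summit.CriticalPhenomena.PercolationContinuityZ3.Theorems

namespace Transplant

namespace KNLevels

open Literature.Probability.Percolation Literature.Probability.LatticeModels SimpleGraph

variable {V : Type*} [DecidableEq V] {G : SimpleGraph V} [G.LocallyFinite]

/-- **One target step**: the data of one application of the target property under a fixed weighting — level datum (levels `X`, source `o`,
support), subbox `D`, target `T`, depth `R`, contact count `N`, level window `[j₀, j₁]`. [cite: KozmaNitzan2024, §4 Lemma 10 (p. 17)] -/
structure TStep (G : SimpleGraph V) where
  /-- the level datum -/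
  L : LData G
  /-- the subbox -/
  D : Finset V
  /-- the target -/
  T : Finset V
  /-- the depth (levels up to `R + 1` lie in `D`) -/
  R : ℕ
  /-- the number of contacts demanded by Step II -/
  N : ℕ
  /-- first level of the window -/
  j₀ : ℕ
  /-- last level of the window -/
  j₁ : ℕ

variable (W : Sym2 V → unitInterval) (p : unitInterval) (Δ : ℕ)

/-- **Kits at accuracy `δ`** for a step: the hypotheses of `TargetProperty` at `δ` (level hypotheses, window inside the depth, nonempty target
inside `D`, enough levels for Step II, and at every level of the window a Step-III seed kit with Step-IV face estimates at accuracy `δ`).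
[cite: KozmaNitzan2024, §4 Lemma 10 (pp. 17–22)] -/
def TStep.KitsAt (s : TStep G) (δ : ℝ) : Prop :=
  LHyp s.L W p s.D s.R ∧ s.j₁ ≤ s.R ∧ s.T ⊆ s.D ∧ s.T.Nonempty ∧
    1 / (1 - (p : ℝ)) ^ (Δ * s.N) ≤ δ * ((Finset.Icc s.j₀ s.j₁).card : ℝ) ∧
    ∀ j ∈ Finset.Icc s.j₀ s.j₁, ∃ (σ : SData V) (S : Finset V), SHyp s.L j σ ∧ σ.N ≤ s.N ∧
      (1 - (p : ℝ) ^ σ.sB) ^ σ.k ≤ δ ∧ S ⊆ s.L.X j ∧ S ⊆ s.D ∧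
      (∀ x ∈ σ.K, ∀ e ∈ σ.seed x, e ∉ wireSet (↑S : Set V)) ∧ (∀ x ∈ σ.K, σ.face x ⊆ S) ∧
      (∀ x ∈ σ.K, 1 - 3 * δ ≤ (prodBernoulli W).real {ω | ∃ u ∈ σ.face x,
        1 - δ < (prodBernoulli (pinW W (wireSet (↑S : Set V)) ω)).real (⋃ t ∈ s.T, openConnIn (↑s.D : Set V) u t)})

variable {W p Δ}

omit [G.LocallyFinite] in
/-- **Kits at accuracy `δ` are kits at every coarser accuracy `δ' ≥ δ`.** [folklore] -/
theorem TStep.KitsAt.mono [G.LocallyFinite] {s : TStep G} {δ δ' : ℝ} (h : s.KitsAt W p Δ δ) (hδδ' : δ ≤ δ') : s.KitsAt W p Δ δ' := by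
  obtain ⟨hL, hj, hTD, hTne, hJ, hkits⟩ := h
  refine ⟨hL, hj, hTD, hTne, hJ.trans (mul_le_mul_of_nonneg_right hδδ' (Nat.cast_nonneg _)), fun j hjJ => ?_⟩
  obtain ⟨σ, S, hσ, hN, hIII, hSX, hSD, hSseed, hUS, hIV⟩ := hkits j hjJ
  refine ⟨σ, S, hσ, hN, hIII.trans hδδ', hSX, hSD, hSseed, hUS, fun x hx => ?_⟩
  refine le_trans (by linarith) ((hIV x hx).trans (measureReal_mono ?_))
  rintro ω ⟨u, hu, hω⟩
  exact ⟨u, hu, lt_of_le_of_lt (by linarith) hω⟩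

/-- **One application of the target property to a step with kits** (unpacking). [cite: KozmaNitzan2024, §4 Lemma 10 (p. 17)] -/
theorem TargetProperty.apply_step {Δ : ℕ} {p : unitInterval} (hT : TargetProperty G Δ p) {ε : ℝ} (hε : 0 < ε) :
    ∃ δ : ℝ, 0 < δ ∧ δ ≤ 1 ∧ ∀ (W : Sym2 V → unitInterval) (s : TStep G), s.KitsAt W p Δ δ →
      1 - δ < (prodBernoulli W).real s.L.reachB → 1 - ε < (prodBernoulli W).real (⋃ t ∈ s.T, openConn s.L.o t) := by
  obtain ⟨δ, hδ, hδ1, h⟩ := hT hε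
  refine ⟨δ, hδ, hδ1, fun W s hk hreach => ?_⟩
  obtain ⟨hL, hj, hTD, hTne, hJ, hkits⟩ := hk
  exact h s.L W s.D s.T s.R s.N s.j₀ s.j₁ hL hj hTD hTne hJ hkits hreach

omit [DecidableEq V] [G.LocallyFinite] in
/-- Linking two steps: if `T ⊆ X'(0)` (same source), reaching `T` implies reaching `B' = X'(0)`. [folklore] -/
theorem real_reachB_ge_of_subset [G.LocallyFinite] (W : Sym2 V → unitInterval) {s s' : TStep G} (ho : s'.L.o = s.L.o)
    (hTB : s.T ⊆ s'.L.X 0) :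
    (prodBernoulli W).real (⋃ t ∈ s.T, openConn s.L.o t) ≤ (prodBernoulli W).real s'.L.reachB := by
  refine measureReal_mono ?_
  intro ω hω
  simp only [Set.mem_iUnion, exists_prop] at hω
  obtain ⟨t, ht, hωt⟩ := hω
  unfold LData.reachB
  rw [ho]
  exact Set.mem_biUnion (Finset.mem_coe.2 (hTB ht)) hωt

/-- **CHAINS of target steps** (the engine of KN's Lemmas 11–12): for every `ε > 0` and `n` there is one accuracy `δ ∈ (0, 1]` such that for
every weighting `W` and every chain `s₀, …, s_n` of steps with a common source, linked by `T_i ⊆ X_{i+1}(0)`, all carrying kits at accuracy `δ`,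
`1 - δ < P_W(o ↔ X_0(0))` implies `1 - ε < P_W(o ↔ T_n)`.  (Backward induction: the last step needs its `B` reached with probability
`> 1 - δ_n`, which the first `n` steps deliver with `ε' = δ_n`; one common `δ` works by `KitsAt.mono`.)
[cite: KozmaNitzan2024, §4 Lemma 11 (p. 22: "each time moving the face"), Lemma 12 (p. 24: the d + 1 applications)] -/
theorem TargetProperty.chain {Δ : ℕ} {p : unitInterval} (hT : TargetProperty G Δ p) (n : ℕ) {ε : ℝ} (hε : 0 < ε) :
    ∃ δ : ℝ, 0 < δ ∧ δ ≤ 1 ∧ ∀ (W : Sym2 V → unitInterval) (s : Fin (n + 1) → TStep G),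
      (∀ i : Fin (n + 1), (s i).L.o = (s 0).L.o) →
      (∀ i : Fin n, (s (Fin.castSucc i)).T ⊆ (s i.succ).L.X 0) →
      (∀ i : Fin (n + 1), (s i).KitsAt W p Δ δ) →
      1 - δ < (prodBernoulli W).real (s 0).L.reachB →
        1 - ε < (prodBernoulli W).real (⋃ t ∈ (s (Fin.last n)).T, openConn (s 0).L.o t) := by
  induction n generalizing ε with
  | zero =>
    obtain ⟨δ, hδ, hδ1, h⟩ := hT.apply_step hε
    refine ⟨δ, hδ, hδ1, fun W s _ _ hk hreach => ?_⟩
    exact h W (s 0) (hk 0) hreach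
  | succ n ih =>
    -- the last step at `ε`, the first `n + 1` steps at `ε' = δ_last`
    obtain ⟨δ₁, hδ₁, hδ₁1, hlast⟩ := hT.apply_step hε
    obtain ⟨δ₀, hδ₀, hδ₀1, hfirst⟩ := ih hδ₁
    refine ⟨min δ₀ δ₁, lt_min hδ₀ hδ₁, (min_le_left _ _).trans hδ₀1, fun W s ho hlink hk hreach => ?_⟩
    -- the truncated chain
    set s' : Fin (n + 1) → TStep G := fun i => s (Fin.castSucc i) with hs'
    have ho' : ∀ i : Fin (n + 1), (s' i).L.o = (s' 0).L.o := fun i => by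
      simp only [hs']; rw [ho (Fin.castSucc i)]; exact (ho (Fin.castSucc 0)).symm
    have hlink' : ∀ i : Fin n, (s' (Fin.castSucc i)).T ⊆ (s' i.succ).L.X 0 := fun i => by
      simp only [hs']
      have := hlink (Fin.castSucc i)
      have e : (Fin.castSucc i).succ = Fin.castSucc i.succ := Fin.ext (by simp)
      rwa [e] at this
    have hk' : ∀ i : Fin (n + 1), (s' i).KitsAt W p Δ δ₀ := fun i => (hk (Fin.castSucc i)).mono (min_le_left _ _)
    have h0 : (s' 0).L.o = (s 0).L.o := rfl
    have hreach' : 1 - δ₀ < (prodBernoulli W).real (s' 0).L.reachB := by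
      have : (s' 0) = s 0 := rfl
      rw [this]; exact lt_of_le_of_lt (by linarith [min_le_left δ₀ δ₁]) hreach
    have hmid := hfirst W s' ho' hlink' hk' hreach'
    -- `T_n ⊆ X_{n+1}(0)`: the last step's `B` is reached
    have hlastlink : (s' (Fin.last n)).T ⊆ (s (Fin.last (n + 1))).L.X 0 := by
      have := hlink (Fin.last n)
      simp only [hs']
      rwa [Fin.succ_last] at this
    have holast : (s (Fin.last (n + 1))).L.o = (s 0).L.o := ho _
    have hreachLast : 1 - δ₁ < (prodBernoulli W).real (s (Fin.last (n + 1))).L.reachB := by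
      refine lt_of_lt_of_le ?_ (real_reachB_ge_of_subset W (s := s' (Fin.last n)) (s' := s (Fin.last (n + 1)))
        (by rw [holast]; exact ho' (Fin.last n) |>.trans h0 |>.symm) hlastlink)
      have e : (s' (Fin.last n)).L.o = (s 0).L.o := (ho' (Fin.last n)).trans h0
      rw [e]; exact hmid
    have := hlast W (s (Fin.last (n + 1))) ((hk _).mono (min_le_right _ _)) hreachLast
    rwa [holast] at this

end KNLevels

end Transplant

end Summit.CriticalPhenomena.PercolationContinuityZ3.Theorems
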